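import Mathlib
import HarnessLib
import HarnessLib.Audit
import Summits.HodgeConjecture.Statement
import Summits.HodgeConjecture.HodgeConjecture.Theorems.WeilTypeLadderSimilarReach
import Summits.HodgeConjecture.HodgeConjecture.Theorems.BlochSeedDiscThreeLiftableDoor
import HarnessLib.Audit.Status.Attr

/-!
Route: SquareNodalUnions

CLOSED (superseded) 2026-08-28T01:24:48Z by planner-hodge-idea-1-g3-0 — reason: superseded:route-HodgeConjecture-DoublyPolarisedTransport — superseded by route-HodgeConjecture-DoublyPolarisedTransport — note: critic STRIKE 2026-08-27T23:47:52Z (rigid transversal codim-3 unions: T¹ = 0 ⇒ census T2(ii) ⊕-kernel, count-independent); X2 SquareSimilarAnchors folded into №8c item 23603 as a proof line (evidence note); director ORDER 00:57Z item 4. The file is kept as the record of this route; refuted decls are indexed as negative knowledge (`ledger negatives`).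

# Route SquareNodalUnions — Markman-free H2 — nodal unions of divisor-built threefolds at squares B
⊞ B lift to every cell

It suffices to show X = X1 ∧ X2 (a LINE for rung H2 = `SevenfoldWeilCensus.WeilSixfolds`, all d, all
cells INCLUDING the hyperbolic one; no summit and no rung is proved by filing it, and Markman's
unrefereed floor is NOT used). A SQUARE is (B ⊞ B, ψ₀ = φ ⊞ (−φ)) for a ℚ(√-d)-threefold (B, φ): a
Weil sixfold of type (3,3) whose K-symmetrised polarisations θ₁ + c·θ₂ (c ∈ ℚ_{>0}) have
discriminant class −c·Nm, i.e. run through EVERY cell, hyperbolic (c ∈ Nm K^×) or not; and whose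
Weil classes are LEFSCHETZ — invariant under the diagonal unitary group U(H_B), since ∧³V₊ ⊗ ∧³V₋
transforms by det·det̄ = 1 — hence algebraic and POLYNOMIALS IN DIVISOR CLASSES θ₁, θ₂, γ_u = E_B(x,
u·y) (Milne 1999, Lefschetz classes on abelian varieties; for generic B of signature (2,1), Ribet's
odd-relative-dimension theorem even gives Hg(B ⊞ B) = L). X2 (SquareSimilarAnchors, anchor supply):
every √-d sixfold target with a non-zero rational (3,3) Weil class is Weil-similar (`IsWeilSimilar`)
to a square carrying a non-zero rational (3,3) Weil class (Landherr). X1 (SquareLiftableCarriers,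
research crux): at every square, some q·h³ + w is carried by an INTEGRAL closed codimension-3
subscheme that lifts étale-locally along every Weil-type family through the square on which the
class stays Hodge (`LiftsAlongWeilFamilies 6 3 d (B ⊞ B) Z κ`). Restrict-then-tighten: restricted
class = squares (HC for their Weil classes is Milne's theorem, refereed, divisor-explicit); tighten
= door L + Deligne's reach through door B (no floor).
Lean: `SquareLiftableCarriers ∧ SquareSimilarAnchors`

## Assembly
Pure logic over two tree doors, no floor: for each d > 0 and each target (A, φ) with a non-zero Weil
class, SquareSimilarAnchors supplies (B, φ_B, e, a, w) with the square Weil-similar to the target;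
SquareLiftableCarriers supplies (Z, κ, q); door L
`BlochSeedDiscThree.weilAnchorLocalClause_of_liftsAlongWeilFamilies` (with FlatClassSpecialises)
gives `WeilAnchorLocalClause 3 d (B ⊞ B) h w`, hence `HasSimilarLocallyAlgebraicWeilAnchors 3 d`;
door B `WeilTypeLadder.weilSixfolds_of_reachSimilar_of_similarAnchors` (with SimilarReach) gives the
rung. The deciding theorem `closes` (glue.lean) is this argument, kernel-checked (Sketch2.lean rc 0,
0 sorry).

CLOSES_TARGET: closes rung H2 of HodgeConjecture: Summit.HodgeConjecture.HodgeConjecture.Theses.SevenfoldWeilCensus.WeilSixfolds (D-0061; not the summit Statement) — the deciding theorem of this route concludes that registered leaf instead of the Statement decl `HodgeConjecture` (class rung: servable and labelled, never counted as concluding the summit Statement).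

Rationale: WHY THIS LINE. Mechanism for X1 (the object is built from divisors, which exist only at Lefschetz
anchors): (i) NEGATIVE RUNG (computed this session, NOTES N5): with NS(B ⊞ B)_ℚ = ⟨θ₁, θ₂, γ_u⟩ no
single complete intersection D₁∩D₂∩D₃ of effective divisors has class in ℚh³ ⊕ W with non-zero
W-part, for any d (Künneth/K-type bookkeeping forces ζ₃ ∈ K and then D_i = γ_{λζ₃^i}, indefinite —
Schoen's μ₃ configuration is the formal solution); (ii) POSITIVE CONE: h³ is interior to the convex
cone spanned by products D₁D₂D₃ of ample classes inside Sym³NS, so m(q·h³ ± w) = Σ_j [Z_j] with Z_j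
smooth ample complete-intersection threefolds meeting pairwise transversally in Z_j·Z_k > 0 points —
a NODAL UNION Z = ∪Z_j whose total class is persistent along the cell while no component's class is;
(iii) NODES AGAINST OBSTRUCTIONS: the obstruction to deforming Z_j alone along a cell direction
lives in H¹(N_{Z_j}) ⊇ H²(𝒪_P)·[other two divisors] (the divisors leave NS), and the gluing at r = Σ
Z_j·Z_k nodes modifies the deformation theory of the union by r local smoothing parameters — the
Hartshorne–Hirschowitz / Severi mechanism («enough nodes make the union unobstructed and
smoothable», LNM 1124 (1985) 98–131; arXiv:1304.5840 for the modern Hilbert-scheme form), here in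
codimension 3 on an abelian sixfold where all cohomology is line-bundle cohomology computable by
Mumford's index theorem; (iv) LINKAGE: a general residual of the lifted union in a relative complete
intersection of multiples of h is integral, giving the integral carrier door L wants. Imported:
liaison and nodal smoothing from curve theory (Peskine–Szpiro, Hartshorne–Hirschowitz), Milne's
Lefschetz-class theorem, Landherr1936HermitianForms; doors L (Artin1969 + FlatClassSpecialises) and
B (`WeilTypeLadder.weilSixfolds_of_reachSimilar_of_similarAnchors`, Deligne1982HodgeCycles Thm 4.8
reach). What listed routes do not do: every sheaf/seed line (EightfoldBlochSeeds,
FirstOrderSemiregularSeeds, HSemireg's perry-cm-tower-all-d, VHCAbelianSchemesRoad) designs ONE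
semiregular object at a CM or eightfold anchor and imports Markman's floor or Q 11.4; the census
no-go T2(ii) (direct sums F ⊕ G never lift: ⊕ of non-zero obstructions) is exactly the r = 0 limit
of (iii) — this line bets on the nodes; BiquadraticSecantLift changes the field; SevenfoldWeilCensus
/ SplitImpliesAll degenerate UP to 7- /8-folds; the sibling line DoublyPolarisedTransport (this seat,
№1) transports Markman's cycle and needs the floor — here the anchor cycle is a divisor polynomial
and the floor is absent. arXiv:2603.20268 (2026) names «an algebraicity criterion valid for all
discriminants simultaneously» as the missing input; squares + nodal unions is a candidate criterion
that does not pass through the hyperbolic component at all.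

RANKED CRUXES. #2 SquareLiftableCarriers (crux) — For every d > 0, every ℚ(√-d)-threefold (B, φ)
with (B ⊞ B).dim = 6, every rational polarisation datum (e, a) on B ⊞ B and every non-zero rational
(3,3) Weil class w of (B ⊞ B, φ ⊞ (−φ)), some q·h³ + w (h the K-symmetrisation of e*a, q ∈ ℚ) is
supported on an integral closed subscheme Z ⊂ B ⊞ B of codimension 3 with `LiftsAlongWeilFamilies 6
3 d (B ⊞ B) Z κ`. Mechanism: nodal unions of ample complete-intersection threefolds with persistent
total class, smoothed/lifted by the node count, then linked to an integral residual. bears_on: rung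
H2 (LADDER-HodgeAV), all cells. Instrument row that refutes the key lemma: at the CM square E_K³ ⊞
E_K³ (weights (1, c), c ∉ Nm) and for the two-component union Z₁ ∪ Z₂ of smallest degree realising
m(q·h³ ± w), the first-order obstruction map T_{cell} → 𝕋²(Z₁ ∪ Z₂) computed from 0 → I_{Z₁∪Z₂} →
I_{Z₁} ⊕ I_{Z₂} → I_{Z₁∩Z₂} → 0 (line-bundle cohomology on E⁶ + r skyscrapers): non-vanishing for
all two-component designs up to a degree bound prices the line; a proof that node contributions can
never reach the H^{0,2}-type obstructions (an index/weight argument) kills the mechanism.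
[difficulty: open-problem] (why it might fail: the obstructions of the components are of global
Hodge type (H^{0,2}(P)·D_jD_k ⊂ H¹(N_{Z_j})) while node smoothings are local; if the local-to-global
map misses that summand for weight reasons, no number of nodes helps and T2(ii) extends from ⊕ to
nodal unions.) [Bloch1972Semiregularity, BuchweitzFlenner2003, arXiv:1304.5840, Artin1969,
arXiv:2603.20268]
#3 SquareSimilarAnchors (crux) — For every d > 0, every ℚ(√-d)-Weil sixfold (A, φ) carrying a
non-zero rational (3,3) Weil class is Weil-similar (`IsWeilSimilar`, matching rational Gram data) to
a square (B ⊞ B, φ_B ⊞ (−φ_B)) with (B ⊞ B).dim = 6, (φ_B ⊞ −φ_B)² = −d, polarised by a rational (e,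
a), and carrying a non-zero rational (3,3) Weil class. Witnesses: B of K-signature (2,1) (generic,
End⁰ = K) or E_K³, weights θ₁ + c·θ₂ realising the class −c·Nm (Landherr: rank, signature and
discriminant classify). [difficulty: M] (why it might fail: IsWeilSimilar is typed with explicit
rational Gram matrices and a common multiplier; the biproduct's cohomology/Künneth bookkeeping (dim,
ψ₀² = −d, Weil class of B ⊞ B from ∧³ ⊗ ∧³) may need tree API (dim_biproduct, weilClassesOf for
biprod) that is only partly landed.) [Landherr1936HermitianForms, vanGeemen1994HodgeAV,
Deligne1982HodgeCycles]
#6 SimilarReach (crux) — Named refereed fact, imported by name: Deligne's reach by similitude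
(Mumford 1969 families; Deligne 1982 proof of Thm 4.8). Crux-kind only because every binder of the
deciding theorem must be an item; shared with route DoublyPolarisedTransport. [difficulty:
provable-now] (why it might fail: only if the tree's IsWeilSimilar is stronger than Deligne's
hypothesis (matrix form with a common multiplier); then the fact as typed is not the published one.)
[Deligne1982HodgeCycles, vanGeemen1994HodgeAV]
#7 FlatClassSpecialises (crux) — Named textbook fact, imported by name: fibre classes of a flat
family of closed subschemes of a smooth projective family are restrictions of one class (Fulton 1998
§10.1 / Voisin II §9.2); consumed by door L; shared with route DoublyPolarisedTransport.
[difficulty: provable-now] (why it might fail: only a typing risk (SchemeOver ℂ families with smooth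
base, as door L uses it); a mismatch would surface as a type error, not a mathematical gap.)
[VoisinHodgeII2003, BuchweitzFlenner2003]

TWO-LAYER PLAN. SquareLiftableCarriers ⇐ (N1) NodalUnionLifts: at every square some nodal union of
ample complete-intersection threefolds with total class m(q·h³ ± w) has an étale-local flat lift
along every Weil family on which the class stays Hodge → (N2) LinkageToIntegral: a liftable reduced
equidimensional carrier yields an integral liftable carrier of a class q′·h³ ∓ w (relative residual
in multiples of h) → SquareLiftableCarriers. SquareSimilarAnchors ⇐ (S1) biproduct bookkeeping (dim,
ψ₀², Weil class ∧³⊗∧³ ≠ 0 of type (3,3)) → (S2) Landherr Gram realisation θ₁ + c·θ₂.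

KILL CRITERIA. Refuted outright (close --reason refuted:SquareLiftableCarriers) by
`WeilRigidObstructed 6 3 d (B ⊞ B) Z κ` for every integral carrier of every q·h³ + w at one square
(the tree's disjunction BlochSeedDiscThreeLiftableDoor:171 makes this the exact negation there).
Mechanism killed (pivot to other divisor-built carriers or retire) by a weight argument showing node
contributions never meet the H^{0,2}-type obstruction summand. Mooted if any sibling H2 line closes
the rung. SquareSimilarAnchors refuted for some similarity class ⇒ replace weights/the threefold B
(signature (3,0) vs (2,1)) before closing.

NOT DECOMPOSED YET. Which union (number of components, degrees), the node-count inequality, the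
linkage step and the choice of lifting formalism (Hilbert-flag of (Y ⊃ Z), 𝕋ⁱ of the union, or BF
semiregularity of 𝒪_Z for the non-lci union) are layer-2 children of SquareLiftableCarriers. Milne's
Lefschetz theorem is used only to MOTIVATE the carriers (the crux does not need w algebraic at the
anchor as a hypothesis); a Literature fact Milne1999 is requested below, not assumed.

CHEAPEST FALSIFIER. Two-component test at the CM square E_K³ ⊞ E_K³, d = 1 or 3, weights (1, c) with
c ∉ Nm: enumerate ample classes D, D′ ∈ NS_ℚ (rank 4 sublattice ⟨θ₁, θ₂, γ_1, γ_φ⟩ suffices) with D³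
+ D′³ ∈ ℚh_c³ ⊕ W and W-part ≠ 0 (exists by the positive-cone lemma for some pair up to scaling —
first check: smallest degrees), then compute the first-order obstruction of Z₁ ∪ Z₂ (Z₁ ∈ |D|³-c.i.,
Z₂ ∈ |D′|³-c.i., r = (DD′)³… nodes) in one h_c-cell direction: Mumford index theorem + r
skyscrapers, exact arithmetic over K — a kit job of HSemireg design-row size. Not run this session
(seat has no engine; recorded as the instrument row). The single-c.i. case WAS run by hand (NOTES
N5): impossible for all d — which is why the line is about unions.

NUMBERS. Cell dimension 9; square locus per cell: 2 (B of signature (2,1): 2·1 moduli) or 0 (E_K³);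
NS(B ⊞ B) rank 4 for End⁰(B) = K (vs 36 at E_K⁶); H^{0,2}(P) = 15, H^{2,4}(P) = 225 (target of the
semiregularity pairing); discriminant classes: all, via c ∈ ℚ_{>0} (class −c·Nm K^×). HSemireg
census at E⁶: 218 sheaf designs, 0 candidates; direct sums excluded by T2(ii).

DEFINITION REQUESTS. - cite fact wanted: Milne 1999 (Lefschetz classes on abelian varieties are
algebraic / spanned by products of divisor classes), as `Literature.AlgebraicGeometry.HodgeTheory`
named fact — motivates the carriers; not a hypothesis of any item.

Novelty: Searches (2026-08-27): lit search --hybrid "abelian variety of Weil type discriminant two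
polarizations split component deformation of algebraic cycle semiregular" (8 docs, none on
squares/nodal unions); lit vsearch (period-domain generalities only); lit search --source all "Weil
type hyperbolic discriminant sixfold algebraic" (arXiv:2603.20268 only relevant); lit search
"Hartshorne Hirschowitz smoothing algebraic space curves nodal" (5 local docs citing LNM 1124:
arXiv:1304.5840, arXiv:1306.1854, arXiv:2505.13187 — curve case only; no abelian-sixfold use); lit
galaxy search "Weil type|secant sheaf|semiregular|semi-regularity" --star all (0 relevant), --star
pdf "Weil type" (0 relevant); tree: rg biprod / weilSixfolds_of_reachSimilar_of_similarAnchors /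
SquareGerm (door T uses TENSOR squares A₁ ⊗ K with the class-level germ crux and the fact
deligne1982_weilFamily_hodgeWeilSection_all; no route files an object at squares of K-threefolds,
none is floor-free through door B); ledger negatives (6, unrelated).
Nearest prior art found: in-tree door T `weilSixfolds_of_deligneAll_of_germs` / TensorLocalAnchorAll
(tensor squares, germ crux, Deligne-all fact); HSemireg STRATEGY-CENSUS (CM tensor point E³ × Ē³ =
the square with B = E³; sheaf designs; T2(ii) ⊕-kernel); Markman2025SecantWeil (hyperbolic only);
Schoen1998HodgeWeilAddendum; Hartshorne–Hirschowitz LNM 1124 (nodal smoothing, curves).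
Delta: a floor-free route to H2 whose anchors are squares of K-THREEFOLDS (Weil classes Lefsc  [refs: 2603.20268, 1304.5840, 1306.1854, 2505.13187]

Barriers (technique_class: variational-hodge, nodal-smoothing, lefschetz-anchor): - technique_class: variational-hodge, nodal-smoothing, lefschetz-anchor
- Literature.Barriers.HodgeConjecture.CattaniDeligneKaplan1995_hodgeLocus_algebraicFor: used, not
fought — liftability is asked exactly over the algebraic locus where q·h³ + w stays Hodge (the
cell); the Voisin 2002 / Zucker obstruction (tree files KaehlerCoherentSheaves*,
KaehlerCounterexamples*) is evaded because all families are POLARISED Weil-type abelian schemes with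
projective fibres and the carriers are subschemes.
- Literature.Barriers.HodgeConjecture.Andre1996_hodgeClassesOnAbelianVarieties_motivated: outside
its class — no motivated-cycle transport; outputs are subschemes algebraised by Artin (door L).
- HSemireg census T2 (ii) (⊕-obstruction kernel: F ⊕ G never lifts when neither summand's class
persists): the nearest negative; the line's whole bet is that transversal gluing at r ≫ 0 nodes
changes 𝕋¹/𝕋² of the union enough to lift — it does not evade the census, it perturbs its hypothesis
(r = 0 → r > 0) and is killable by the same machinery.
- Negatives index: the 6 refuted HodgeConjecture statements concern other objects (SparseFermat,
MilnorK, So7 theta, MirrorBraneLift, DerivedTorelliFermat, ELineTransport); none restated.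
TropicalCuspLift's refuted DepthOneLogLift is a boundary lift; this line is interior.

History (route lifecycle, newest last):
- 2026-08-28T01:24:48Z · CLOSED superseded — superseded:route-HodgeConjecture-DoublyPolarisedTransport (planner-hodge-idea-1-g3-0)

sub-problem: HodgeConjecture · status: closed(superseded) · opened planner-hodge-idea-1-g2-0 2026-08-27T23:37:47Z · rev 0 · ledger route-HodgeConjecture-SquareNodalUnions
GENERATED by the gate from the ledger (D-0016/17). Provers cite these decls: `theorem foo : Summit.HodgeConjecture.HodgeConjecture.Theses.SquareNodalUnions.<Decl> := …` in Summits/HodgeConjecture/HodgeConjecture/Theorems/<Name>.lean.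
-/

namespace Summit.HodgeConjecture.HodgeConjecture.Theses.SquareNodalUnions

open scoped BigOperators Topology Manifold Classical MeasureTheory ProbabilityTheory Matrix InnerProductSpace ComplexConjugate ContinuousMap
open Filter Set Function TopologicalSpace MeasureTheory

attribute [summit_statement] _root_.HodgeConjecture
attribute [summit_statement] _root_.Summit.HodgeConjecture.HodgeConjecture.Theses.SevenfoldWeilCensus.WeilSixfolds

/-- item stmt-HodgeConjecture-23704 · crux · rank 2 · closed · moot by None · by planner
why it might fail: the obstructions of the components are of global Hodge type (H^{0,2}(P)·D_jD_k ⊂ H¹(N_{Z_j})) while node smoothings are local; if the local-to-global map misses that summand for weight reasons, no number of nodes helps and T2(ii) extends from ⊕ to nodal unions.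
sources: Bloch1972Semiregularity, BuchweitzFlenner2003, arXiv:1304.5840, Artin1969, arXiv:2603.20268
[crux] For every d > 0, every ℚ(√-d)-threefold (B, φ) with (B ⊞ B).dim = 6, every rational
polarisation datum (e, a) on B ⊞ B and every non-zero rational (3,3) Weil class w of (B ⊞ B, φ ⊞
(−φ)), some q·h³ + w (h the K-symmetrisation of e*a, q ∈ ℚ) is supported on an integral closed
subscheme Z ⊂ B ⊞ B of codimension 3 with `LiftsAlongWeilFamilies 6 3 d (B ⊞ B) Z κ`. Mechanism:
nodal unions of ample complete-intersection threefolds with persistent total class, smoothed/lifted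
by the node count, then linked to an integral residual. bears_on: rung H2 (LADDER-HodgeAV), all
cells. Instrument row that refutes the key lemma: at the CM square E_K³ ⊞ E_K³ (weights (1, c), c ∉
Nm) and for the two-component union Z₁ ∪ Z₂ of smallest degree realising m(q·h³ ± w), the
first-order obstruction map T_{cell} → 𝕋²(Z₁ ∪ Z₂) computed from 0 → I_{Z₁∪Z₂} → I_{Z₁} ⊕ I_{Z₂} →
I_{Z₁∩Z₂} → 0 (line-bundle cohomology on E⁶ + r skyscrapers): non-vanishing for all two-component
designs up to a degree bound prices the line; a proof that node contributions can never reach the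
H^{0,2}-type obstructions (an index/weight argument) kills the mechanism. [difficulty: open-problem] -/
@[route_item "route-HodgeConjecture-SquareNodalUnions", crux]
def SquareLiftableCarriers : Prop :=
  ∀ d : ℕ, 0 < d → ∀ (B : Literature.AlgebraicGeometry.Motives.AbelianVariety ℂ) (φ : B ⟶ B) (e : Literature.AlgebraicGeometry.Motives.ProjectiveEmbedding (CategoryTheory.Limits.biprod B B).X) (a : Literature.AlgebraicGeometry.HodgeTheory.complexBetti (Literature.AlgebraicGeometry.Motives.projectiveSpace e.n ℂ) 2) (w : Literature.AlgebraicGeometry.HodgeTheory.complexBetti (CategoryTheory.Limits.biprod B B).X (2 * 3)), (CategoryTheory.Limits.biprod B B).dim = 2 * 3 → CategoryTheory.CategoryStruct.comp (CategoryTheory.Limits.biprod.map φ (-φ)) (CategoryTheory.Limits.biprod.map φ (-φ)) = -(d • CategoryTheory.CategoryStruct.id (CategoryTheory.Limits.biprod B B)) → Literature.AlgebraicGeometry.HodgeTheory.IsRationalClass a → a ≠ 0 → w ∈ Literature.AlgebraicGeometry.HodgeTheory.weilClassesOf (CategoryTheory.Limits.biprod B B) (CategoryTheory.Limits.biprod.map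 φ (-φ)) 3 d → Literature.AlgebraicGeometry.HodgeTheory.IsRationalClass w → w ≠ 0 → Literature.AlgebraicGeometry.HodgeTheory.IsOfHodgeType (2 * 3) (CategoryTheory.Limits.biprod B B).X (2 * 3) 3 3 w → ∃ (Z : AlgebraicGeometry.Scheme.{0}) (κ : Z ⟶ (CategoryTheory.Limits.biprod B B).X.left) (q : ℚ), AlgebraicGeometry.IsClosedImmersion κ ∧ AlgebraicGeometry.IsIntegral Z ∧ (∀ z ∈ Set.range κ.base, ((3 : ℕ) : ℕ∞) ≤ Order.coheight z) ∧ (∃ z : Z, Order.coheight (κ.base z) = ((3 : ℕ) : ℕ∞)) ∧ (((q : ℚ) : ℂ) • Literature.AlgebraicGeometry.HodgeTheory.cupPowTwo ((d : ℂ) • Literature.AlgebraicGeometry.HodgeTheory.complexBetti.map e.ι 2 a + Literature.AlgebraicGeometry.HodgeTheory.complexBetti.map (CategoryTheory.Limits.biprod.map φ (-φ)).hom.hom.hom 2 (Literature.AlgebraicGeometry.HodgeTheory.complexBetti.map e.ι 2 a)) 3 + w ∈ Literature.AlgebraicGeometry.HodgeTheory.classesSupportedOn (CategoryTheory.Limits.biprod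 B B).X (Set.range κ.base) (2 * 3)) ∧ Literature.AlgebraicGeometry.HodgeTheory.LiftsAlongWeilFamilies (2 * 3) 3 d (CategoryTheory.Limits.biprod B B) Z κ

/-- item stmt-HodgeConjecture-23705 · crux · rank 3 · closed · moot by None · by planner
why it might fail: IsWeilSimilar is typed with explicit rational Gram matrices and a common multiplier; the biproduct's cohomology/Künneth bookkeeping (dim, ψ₀² = −d, Weil class of B ⊞ B from ∧³ ⊗ ∧³) may need tree API (dim_biproduct, weilClassesOf for biprod) that is only partly landed.
sources: Landherr1936HermitianForms, vanGeemen1994HodgeAV, Deligne1982HodgeCycles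
[crux] For every d > 0, every ℚ(√-d)-Weil sixfold (A, φ) carrying a non-zero rational (3,3) Weil
class is Weil-similar (`IsWeilSimilar`, matching rational Gram data) to a square (B ⊞ B, φ_B ⊞
(−φ_B)) with (B ⊞ B).dim = 6, (φ_B ⊞ −φ_B)² = −d, polarised by a rational (e, a), and carrying a
non-zero rational (3,3) Weil class. Witnesses: B of K-signature (2,1) (generic, End⁰ = K) or E_K³,
weights θ₁ + c·θ₂ realising the class −c·Nm (Landherr: rank, signature and discriminant classify).
[difficulty: M] -/
@[route_item "route-HodgeConjecture-SquareNodalUnions", crux]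
def SquareSimilarAnchors : Prop :=
  ∀ d : ℕ, 0 < d → ∀ (A : Literature.AlgebraicGeometry.Motives.AbelianVariety ℂ) (φ : A ⟶ A), A.dim = 2 * 3 → CategoryTheory.CategoryStruct.comp φ φ = -(d • CategoryTheory.CategoryStruct.id A) → (∃ wA : Literature.AlgebraicGeometry.HodgeTheory.complexBetti A.X (2 * 3), wA ∈ Literature.AlgebraicGeometry.HodgeTheory.weilClassesOf A φ 3 d ∧ wA ≠ 0 ∧ Literature.AlgebraicGeometry.HodgeTheory.IsOfHodgeType (2 * 3) A.X (2 * 3) 3 3 wA) → ∃ (eA : Literature.AlgebraicGeometry.Motives.ProjectiveEmbedding A.X) (aA : Literature.AlgebraicGeometry.HodgeTheory.complexBetti (Literature.AlgebraicGeometry.Motives.projectiveSpace eA.n ℂ) 2) (B : Literature.AlgebraicGeometry.Motives.AbelianVariety ℂ) (φB : B ⟶ B) (e : Literature.AlgebraicGeometry.Motives.ProjectiveEmbedding (CategoryTheory.Limits.biprod B B).X) (a : Literature.AlgebraicGeometry.HodgeTheory.complexBetti (Literature.AlgebraicGeometry.Motives.projectiveSpace e.n ℂ) 2) (w : Literature.AlgebraicGeometry.HodgeTheory.complexBetti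 (CategoryTheory.Limits.biprod B B).X (2 * 3)), Literature.AlgebraicGeometry.HodgeTheory.IsRationalClass aA ∧ aA ≠ 0 ∧ (CategoryTheory.Limits.biprod B B).dim = 2 * 3 ∧ CategoryTheory.CategoryStruct.comp (CategoryTheory.Limits.biprod.map φB (-φB)) (CategoryTheory.Limits.biprod.map φB (-φB)) = -(d • CategoryTheory.CategoryStruct.id (CategoryTheory.Limits.biprod B B)) ∧ Literature.AlgebraicGeometry.HodgeTheory.IsRationalClass a ∧ a ≠ 0 ∧ w ∈ Literature.AlgebraicGeometry.HodgeTheory.weilClassesOf (CategoryTheory.Limits.biprod B B) (CategoryTheory.Limits.biprod.map φB (-φB)) 3 d ∧ Literature.AlgebraicGeometry.HodgeTheory.IsRationalClass w ∧ w ≠ 0 ∧ Literature.AlgebraicGeometry.HodgeTheory.IsOfHodgeType (2 * 3) (CategoryTheory.Limits.biprod B B).X (2 * 3) 3 3 w ∧ Literature.AlgebraicGeometry.Motives.IsWeilSimilar 3 (CategoryTheory.Limits.biprod B B) (CategoryTheory.Limits.biprod.map φB (-φB)) ((d : ℂ) • Literature.AlgebraicGeometry.HodgeTheory.complexBetti.map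 e.ι 2 a + Literature.AlgebraicGeometry.HodgeTheory.complexBetti.map (CategoryTheory.Limits.biprod.map φB (-φB)).hom.hom.hom 2 (Literature.AlgebraicGeometry.HodgeTheory.complexBetti.map e.ι 2 a)) A φ ((d : ℂ) • Literature.AlgebraicGeometry.HodgeTheory.complexBetti.map eA.ι 2 aA + Literature.AlgebraicGeometry.HodgeTheory.complexBetti.map φ.hom.hom.hom 2 (Literature.AlgebraicGeometry.HodgeTheory.complexBetti.map eA.ι 2 aA))

/-- item stmt-HodgeConjecture-23605 · crux · rank 6 · open · by planner
why it might fail: only if the tree's IsWeilSimilar is stronger than Deligne's hypothesis (matrix form with a common multiplier); then the fact as typed is not the published one.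
sources: Deligne1982HodgeCycles, vanGeemen1994HodgeAV
[crux] Named refereed fact, imported by name: Deligne's reach by similitude — two polarised
Weil-type abelian varieties with similar rational Hermitian data lie in one connected Weil-type
family (Mumford 1969 families; Deligne 1982 proof of Thm 4.8). [difficulty: provable-now] -/
@[route_item "route-HodgeConjecture-SquareNodalUnions", crux]
def SimilarReach : Prop :=
  Literature.AlgebraicGeometry.HodgeTheory.weilFamilyReach_similar

/-- item stmt-HodgeConjecture-23606 · crux · rank 7 · open · by planner
why it might fail: only a typing risk (SchemeOver ℂ families with smooth base, as door L uses it); a mismatch would surface as a type error, not a mathematical gap.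
sources: VoisinHodgeII2003, BuchweitzFlenner2003
[crux] Named textbook fact, imported by name: the fibre classes of a flat family of closed
subschemes of a smooth projective family are the restrictions of one class (Fulton 1998 §10.1 /
Voisin II §9.2); consumed by door L. [difficulty: provable-now] -/
@[route_item "route-HodgeConjecture-SquareNodalUnions", crux]
def FlatClassSpecialises : Prop :=
  Literature.AlgebraicGeometry.HodgeTheory.fulton1998_flatFamily_cycleClass_specialises

/-- item stmt-HodgeConjecture-23706 · assembly · rank 1 · closed · moot by None · by planner
sources: Deligne1982HodgeCycles, Artin1969
[assembly] SquareLiftableCarriers → SquareSimilarAnchors → SimilarReach → FlatClassSpecialises →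
WeilSixfolds (rung H2). -/
@[route_item "route-HodgeConjecture-SquareNodalUnions"]
def Assembly : Prop :=
  SquareLiftableCarriers → SquareSimilarAnchors → SimilarReach → FlatClassSpecialises → Summit.HodgeConjecture.HodgeConjecture.Theses.SevenfoldWeilCensus.WeilSixfolds

/-! D-0027 §2.1 — DECIDING THEOREM (planner-authored via `route open/edit --closes-file`; by planner-hodge-idea-1-g2-0 2026-08-27T23:37:47Z) — ARCHIVED: route closed (superseded) 2026-08-28T01:24:48Z; kept so importers keep building:
its hypotheses are this route's items and its conclusion the registered leaf `Summit.HodgeConjecture.HodgeConjecture.Theses.SevenfoldWeilCensus.WeilSixfolds` (rung H2, D-0061) (glue_lint), and it elaborates with this file. -/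

@[closes "route-HodgeConjecture-SquareNodalUnions"] theorem closes (h₁ : SquareLiftableCarriers) (h₂ : SquareSimilarAnchors) (h₃ : SimilarReach)
    (h₄ : FlatClassSpecialises) :
    Summit.HodgeConjecture.HodgeConjecture.Theses.SevenfoldWeilCensus.WeilSixfolds :=
  Summit.HodgeConjecture.HodgeConjecture.WeilTypeLadder.weilSixfolds_of_reachSimilar_of_similarAnchors h₃
    (fun d hd A φ hA hφ hwA => by
      obtain ⟨eA, aA, B, φB, e, a, w, haA, haA0, hdim, hψ, ha, ha0, hwW, hwrat, hw0, hwH, hsim⟩ :=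
        h₂ d hd A φ hA hφ hwA
      obtain ⟨Z, κ, q, hκ, hint, hcoh, hcohp, hsupp, hL⟩ :=
        h₁ d hd B φB e a w hdim hψ ha ha0 hwW hwrat hw0 hwH
      exact ⟨eA, aA, CategoryTheory.Limits.biprod B B, CategoryTheory.Limits.biprod.map φB (-φB), e, a, w, haA,
        haA0, hdim, hψ, ha, ha0, hwW, hwrat, hw0, hwH,
        Summit.HodgeConjecture.HodgeConjecture.Theorems.BlochSeedDiscThree.weilAnchorLocalClause_of_liftsAlongWeilFamilies
          h₄ hκ hint hcoh hcohp hsupp hL, hsim⟩)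

end Summit.HodgeConjecture.HodgeConjecture.Theses.SquareNodalUnions
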